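import Mathlib
import Summits.QuantumAdvantage.QuantumAdvantage.Theorems.MobiusLadderDigitPolyUniformityLiouvilleAutomatic
import Summits.QuantumAdvantage.QuantumAdvantage.Theorems.MobiusLadderDigitPolyUniformityAutomaticDyadic

/-!
# Crux `DigitPolyUniformity` (stmt-QuantumAdvantage-1392), automatic phases in an arbitrary base:
# the dyadic crux form from Müllner's theorem

Line Sketch of the crux, class of AUTOMATIC phases (modulo Müllner 2017). The base-`2` passage
`digitPolyUniformity_automatic_of_liouville` takes as hypothesis the `λ`-orthogonality of every
`2`-automatic sequence; aligned block-diagonal phases (e.g. the inner-product bent function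
`x₀x₁ + x₂x₃ + ⋯`) are naturally `2ᵇ`-automatic, so we record the same dyadic bound for a real
weight `φ` whose complexification is `k`-automatic for an ARBITRARY base `k ≥ 2`, directly from the
named fact `Literature.NumberTheory.LFunctions.mullner_moebius_automatic` via the tree theorem
`liouville_automatic_of_mullner`: get `N₀` with `‖Σ_{m ≤ N} φ(m) λ(m)‖ ≤ ε N` for `N ≥ N₀`,
specialise to `N = 2ⁿ − 1` (so `range (N + 1) = range (2ⁿ)`, and `N ≥ N₀` once `n ≥ N₀ + 1`),
identify the complex sum with the cast of the real one, and bound `ε (2ⁿ − 1) ≤ ε 2ⁿ`.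
-/

set_option linter.dupNamespace false -- D-0017: single-problem summit ⇒ QuantumAdvantage.QuantumAdvantage by design

namespace Summit.QuantumAdvantage.QuantumAdvantage.Theorems.MobiusLadder

/-- **Automatic phases in base `k`, dyadic form.** Assuming the named fact
`mullner_moebius_automatic` (Müllner 2017, Thm. 1.2), for every base `k ≥ 2`, every real weight
`φ : ℕ → ℝ` whose complexification `N ↦ (φ N : ℂ)` is `k`-automatic and every `ε > 0`, eventually
in `n`, `|Σ_{N < 2ⁿ} λ(N) φ(N)| ≤ ε · 2ⁿ`. Proof: `liouville_automatic_of_mullner` gives `N₀` with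
`‖Σ_{m ≤ N} φ(m) λ(m)‖ ≤ ε N` for `N ≥ N₀`; take `N = 2ⁿ − 1 ≥ N₀` (valid once `n ≥ N₀ + 1`, as
`n < 2ⁿ`), so that `range (N + 1) = range (2ⁿ)`; the complex sum is the cast of the real sum, its
norm is the absolute value, and `ε (2ⁿ − 1) ≤ ε 2ⁿ`. [cite: Mullner2017, Thm. 1.2] -/
theorem digitPolyUniformity_automatic_base :
    Literature.NumberTheory.LFunctions.mullner_moebius_automatic → ∀ k : ℕ, 2 ≤ k → ∀ φ : ℕ → ℝ, Literature.NumberTheory.LFunctions.IsAutomaticSeq k (fun N => (φ N : ℂ)) → ∀ ε : ℝ, 0 < ε → ∀ᶠ n : ℕ in Filter.atTop, |∑ N ∈ Finset.range (2 ^ n), ((ArithmeticFunction.liouville N : ℤ) : ℝ) * φ N| ≤ ε * (2 : ℝ) ^ n := by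
  intro hM k hk φ hφ ε hε
  obtain ⟨N₀, hN₀⟩ := liouville_automatic_of_mullner hM k hk (fun N => (φ N : ℂ)) hφ ε hε
  refine (Filter.eventually_ge_atTop (N₀ + 1)).mono fun n hn => ?_
  have key : ‖∑ m ∈ Finset.range (2 ^ n - 1 + 1),
      (φ m : ℂ) * (ArithmeticFunction.liouville m : ℂ)‖ ≤ ε * ((2 ^ n - 1 : ℕ) : ℝ) :=
    hN₀ (2 ^ n - 1) (AutomaticDyadic.le_two_pow_sub_one hn)
  rw [Nat.sub_add_cancel Nat.one_le_two_pow, AutomaticDyadic.sum_ofReal_mul_liouville,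
    Complex.norm_real, Real.norm_eq_abs] at key
  exact key.trans (mul_le_mul_of_nonneg_left (AutomaticDyadic.cast_two_pow_sub_one_le n) hε.le)

end Summit.QuantumAdvantage.QuantumAdvantage.Theorems.MobiusLadder
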